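import Summits.ResolutionOfSingularities.ResolutionOfSingularities.Theorems.EquisingularLiftEquisingularLiftNatCarrierDeltaStalks
import Literature.AlgebraicGeometry.Resolution.ProOpenIdealExtension
import HarnessLib

/-!
# [OURS · L1 W4.5(b)] T-CARRIER-Δ brick K-CONE: an ideal sheaf with PRESCRIBED STALK at a point
# (the global cone `K ⊆ 𝒪_{X'}` with `K_{s(s₀)} = (Φ(c))` consumed by `…CarrierDeltaStalks/Flat/Regular`)

Support file of the crux chain w45b (cell `res-hironaka`, LADDER-RESOLUTION rung L, slot W4.5(b)), working crux
**EL♮ = `Theses.EquisingularLift.EquisingularLiftNat`** (stmt-ResolutionOfSingularities-20038), registered stub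
`stub_elnat_tcDeltaPointResolution`; supplier assembly HΔ(AdmTC) of res-D-pv-029's T-INST (p515248), brick (a) «K-CONE» of
res-type-100's line 2026-08-27T08:49Z. OURS; NOT a statement of any manuscript; AI-written, weaker than expert review. Filed
`--supports stmt-ResolutionOfSingularities-20038 --as helper`.

The T-CARRIER-Δ theorems (p509910, p512232, p513634) take an ideal sheaf `K` on the base `X'` of the section blow-up whose
stalk at the `O`-point `p = s(s₀)` is the principal ideal `(Φ(c))` of a cone form. This file constructs, for ANY scheme
`X`, point `p` and ideal `I ⊆ 𝒪_{X,p}`, such a `K` with no choices: the kernel ideal sheaf of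
`Spec (𝒪_{X,p}/I) → Spec 𝒪_{X,p} → X` (Mathlib `Scheme.Hom.ker`, the scheme-theoretic image; for `I = (G̃)` this is
the schematic closure in `X` of the cone hypersurface germ `V(G̃)`):

* **`stalkIdeal_ker_specMap_fromSpecStalk`** — `(ker (Spec (𝒪_{X,p}/I) → X))_p = I` whenever the morphism is
  quasi-compact; `stalkIdeal_coneIdeal` — the same for `X` locally Noetherian (quasi-compactness automatic);
* `ideal_ker_specMap_fromSpecStalk` — on an affine `U ∋ p` the ideal of sections is `germ⁻¹(I)`.

Proof: on an affine `U ∋ p` the kernel ideal is `germ⁻¹(I)` (Mathlib `Scheme.Hom.ker_apply`, `Scheme.fromSpecStalk_app` in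
the form `appLE_fromSpecStalk_top` of the tree's `ProOpenIdealExtension`, `ΓSpecIso_inv_naturality`), and an ideal of the
localisation `𝒪_{X,p} = Γ(X, U)_𝔭` is extended from its contraction (`IsLocalization.map_comap`).

References: The Stacks Project, Tags 01R8 (scheme-theoretic image), 01J7; M. Temkin, Adv. Math. 219 (2008) Lemma 2.1.1
(the tree's `exists_idealSheaf_extension_fromSpecStalk` is the same device for the pro-open `Spec 𝒪_{X,x} ×_X X'`).
-/

set_option linter.dupNamespace false -- mandated namespace `Summit.<Summit>.<Problem>` of this single-conjunct summit

noncomputable section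

open CategoryTheory AlgebraicGeometry TopologicalSpace IsLocalRing Opposite
open Literature.AlgebraicGeometry.Resolution

namespace Summit.ResolutionOfSingularities.ResolutionOfSingularities.Cruxes.EquisingularLiftNat.Sections

universe u

variable {X : Scheme.{u}} (p : X) (I : Ideal (X.presheaf.stalk p))

/-- The preimage of an open neighbourhood of `p` under `Spec (𝒪_{X,p}/I) → X` is everything. [folklore] -/
theorem preimage_specMap_fromSpecStalk_eq_top (U : X.Opens) (hpU : p ∈ U) :
    (Spec.map (CommRingCat.ofHom (Ideal.Quotient.mk I)) ≫ X.fromSpecStalk p) ⁻¹ᵁ U = ⊤ := by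
  rw [Scheme.Hom.comp_preimage, preimage_fromSpecStalk_eq_top p U hpU]
  rfl

/-- **On an affine open `U ∋ p`, the kernel ideal of `Spec (𝒪_{X,p}/I) → X` is `germ⁻¹(I)`.** [folklore] -/
theorem ideal_ker_specMap_fromSpecStalk (U : X.affineOpens) (hpU : p ∈ (U : X.Opens))
    [QuasiCompact (Spec.map (CommRingCat.ofHom (Ideal.Quotient.mk I)) ≫ X.fromSpecStalk p)] :
    (Spec.map (CommRingCat.ofHom (Ideal.Quotient.mk I)) ≫ X.fromSpecStalk p).ker.ideal U =
      I.comap (X.presheaf.germ U p hpU).hom := by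
  have htop : (Spec.map (CommRingCat.ofHom (Ideal.Quotient.mk I)) ≫ X.fromSpecStalk p) ⁻¹ᵁ (U : X.Opens) = ⊤ :=
    preimage_specMap_fromSpecStalk_eq_top p I U hpU
  have hle : (⊤ : (Spec (.of (X.presheaf.stalk p ⧸ I))).Opens) ≤
      (Spec.map (CommRingCat.ofHom (Ideal.Quotient.mk I)) ≫ X.fromSpecStalk p) ⁻¹ᵁ (U : X.Opens) := htop.ge
  -- `f.appLE U ⊤ = germ ≫ mk ≫ ΓSpecIso⁻¹`
  have happLE : (Spec.map (CommRingCat.ofHom (Ideal.Quotient.mk I)) ≫ X.fromSpecStalk p).appLE U ⊤ hle =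
      X.presheaf.germ U p hpU ≫ CommRingCat.ofHom (Ideal.Quotient.mk I) ≫
        (Scheme.ΓSpecIso (.of (X.presheaf.stalk p ⧸ I))).inv := by
    rw [← Scheme.Hom.appLE_comp_appLE _ _ (U : X.Opens) ⊤ ⊤ (top_le_preimage_fromSpecStalk p U hpU) le_top,
      appLE_fromSpecStalk_top p U hpU, Category.assoc]
    congr 1
    have h2 : (Spec.map (CommRingCat.ofHom (Ideal.Quotient.mk I))).appLE ⊤ ⊤ le_top =
        (Spec.map (CommRingCat.ofHom (Ideal.Quotient.mk I))).appTop :=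
      Scheme.Hom.appLE_eq_app _
    rw [h2]
    exact (Scheme.ΓSpecIso_inv_naturality (CommRingCat.ofHom (Ideal.Quotient.mk I))).symm
  -- `f.app U = f.appLE U ⊤ ≫ (iso)` since `f⁻¹ U = ⊤`
  have heq : homOfLE hle = eqToHom htop.symm := Subsingleton.elim _ _
  haveI : IsIso ((Spec (.of (X.presheaf.stalk p ⧸ I))).presheaf.map (homOfLE hle).op) := by
    rw [heq, eqToHom_op]; infer_instance
  have happ : (Spec.map (CommRingCat.ofHom (Ideal.Quotient.mk I)) ≫ X.fromSpecStalk p).appLE U ⊤ hle =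
      (Spec.map (CommRingCat.ofHom (Ideal.Quotient.mk I)) ≫ X.fromSpecStalk p).app U ≫
        (Spec (.of (X.presheaf.stalk p ⧸ I))).presheaf.map (homOfLE hle).op := rfl
  ext a
  rw [Scheme.Hom.ker_apply, RingHom.mem_ker, Ideal.mem_comap]
  constructor
  · intro ha
    have h1 : ((Spec.map (CommRingCat.ofHom (Ideal.Quotient.mk I)) ≫ X.fromSpecStalk p).appLE U ⊤ hle).hom a = 0 := by
      rw [happ, CommRingCat.comp_apply, ha, map_zero]
    rw [happLE, CommRingCat.comp_apply, CommRingCat.comp_apply] at h1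
    have h2 : (CommRingCat.ofHom (Ideal.Quotient.mk I)).hom ((X.presheaf.germ U p hpU).hom a) = 0 :=
      (ConcreteCategory.injective_of_mono_of_preservesPullback
        (Scheme.ΓSpecIso (.of (X.presheaf.stalk p ⧸ I))).inv) (h1.trans (map_zero _).symm)
    exact Ideal.Quotient.eq_zero_iff_mem.mp h2
  · intro ha
    have h1 : ((Spec.map (CommRingCat.ofHom (Ideal.Quotient.mk I)) ≫ X.fromSpecStalk p).appLE U ⊤ hle).hom a = 0 := by
      rw [happLE, CommRingCat.comp_apply, CommRingCat.comp_apply]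
      change (Scheme.ΓSpecIso (.of (X.presheaf.stalk p ⧸ I))).inv.hom
        (Ideal.Quotient.mk I ((X.presheaf.germ U p hpU).hom a)) = 0
      rw [Ideal.Quotient.eq_zero_iff_mem.mpr ha, map_zero]
    rw [happ, CommRingCat.comp_apply] at h1
    exact (ConcreteCategory.injective_of_mono_of_preservesPullback
      ((Spec (.of (X.presheaf.stalk p ⧸ I))).presheaf.map (homOfLE hle).op)) (h1.trans (map_zero _).symm)

/-- **An ideal sheaf with prescribed stalk: `(ker (Spec (𝒪_{X,p}/I) → X))_p = I`** (the morphism being quasi-compact).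
[cite: StacksProject, Tag 01R8] -/
theorem stalkIdeal_ker_specMap_fromSpecStalk
    [QuasiCompact (Spec.map (CommRingCat.ofHom (Ideal.Quotient.mk I)) ≫ X.fromSpecStalk p)] :
    stalkIdeal (Spec.map (CommRingCat.ofHom (Ideal.Quotient.mk I)) ≫ X.fromSpecStalk p).ker p = I := by
  obtain ⟨U, hU, hpU, -⟩ :=
    TopologicalSpace.Opens.isBasis_iff_nbhd.mp X.isBasis_affineOpens (Opens.mem_top p) (U := ⊤)
  rw [stalkIdeal_eq_map_germ _ ⟨U, hU⟩ hpU, ideal_ker_specMap_fromSpecStalk p I ⟨U, hU⟩ hpU]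
  letI := (X.presheaf.germ U p hpU).hom.toAlgebra
  haveI : IsLocalization.AtPrime (X.presheaf.stalk p) (hU.primeIdealOf ⟨p, hpU⟩).asIdeal := hU.isLocalization_stalk ⟨p, hpU⟩
  exact IsLocalization.map_under (hU.primeIdealOf ⟨p, hpU⟩).asIdeal.primeCompl (S := X.presheaf.stalk p) I

/-- The same for `X` locally Noetherian: `Spec (𝒪_{X,p}/I)` is a Noetherian scheme, so the morphism is quasi-compact.
[cite: StacksProject, Tag 01R8] -/
theorem stalkIdeal_coneIdeal [IsLocallyNoetherian X] :
    stalkIdeal (Spec.map (CommRingCat.ofHom (Ideal.Quotient.mk I)) ≫ X.fromSpecStalk p).ker p = I := by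
  haveI : IsNoetherianRing (CommRingCat.of (X.presheaf.stalk p ⧸ I)) :=
    inferInstanceAs (IsNoetherianRing (X.presheaf.stalk p ⧸ I))
  exact stalkIdeal_ker_specMap_fromSpecStalk p I

end Summit.ResolutionOfSingularities.ResolutionOfSingularities.Cruxes.EquisingularLiftNat.Sections

end
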